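import Literature.MathematicalPhysics.QuantumFieldTheory.Balaban1983to89.B8Prop3PrintedZdGF3P2Gamma
import Literature.MathematicalPhysics.QuantumFieldTheory.Balaban1983to89.B8LeafModelZdPerProp3OfSockPer
import Literature.MathematicalPhysics.QuantumFieldTheory.Balaban1983to89.B8LeafModelZd3SockH2Per
import Literature.MathematicalPhysics.QuantumFieldTheory.Balaban1983to89.Node00.CarriersB8SubBP2DPerKappa

/-!
# `Balaban1983to89.B8Prop3PrintedZdGF3P2GammaOfSockPer` — [Balaban1985RegularSpaces] PROPOSITION 3 (p. 87) AT THE EDITION-δ₂ P-CARRIER `zdGF3P₂` FOR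
# **PERIODIC PAIRS**, FROM THE **PERIODIC-GUARDED** BOTH-POINTS SOCKET `SockB9P3H2Per` — dag-n05-d's D3₂ `prop3Printed_zdGF3P₂_map_γ` RE-RUN ON PERIODIC DATA
# (the H2 ∕ δ₂ suppliers' currency of the (β′-PERIODIC) road under P4 ANSWER (ii))

statement-level skeleton of published theorems with citation tags; proofs where landed; nothing here is a claim about the Yang–Mills mass gap

T. Bałaban, *Spaces of regular gauge field configurations on a lattice and gauge fixing conditions*, Commun. Math. Phys. **99** (1985) 75–102
`[Balaban1985RegularSpaces]` ("B8"): Prop. 3 p. 87, (1.40)–(1.42) p. 83, (1.57)–(1.62) pp. 86–87, (1.36)–(1.39) p. 82, (1.31) p. 82, p. 77 («Ω_j ⊂ T_η»).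
`[Balaban1985BackgroundPropagators]` ("[4]") Thm 3.3 pp. 398–399, (3.40) p. 397 (the Hölder seminorm on `Ω_j`).  `[Balaban1985Averaging]` (4) p. 18 (the torus).

## WHY THIS FILE (cell `pub-ymgap`, HUMAN RULING D-0062; width seat `pub-ymgap-dag-n05-w1` (g4); dag-n05-d P4 ANSWER (ii) 2026-08-28 14:20Z «P4 = the P₂D-model
## periodic twin: member `zdGF3HP₂ ↦ zdGF3HP₂Per`, binders at periodic members»; dag-n06-b WORD-26 (Q-a); lit-balaban word #27 «N06 suppliers conclude the GUARDED socket»)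

The twin of this seat's `B8LeafModelZdPerProp3OfSockPer` (Proposition 3 on `zdGF3`'s periodic pairs from the guarded `SockB9P3Per`) IN THE δ₂ CURRENCY: the (β′-PERIODIC) road
under (ii) reads Proposition 3 on the P₂D member model (`zdGF3P₂`: the Hölder member of (1.36) over pairs with BOTH points in `Ω_j`, (1.37) over print's `towerBondsP`),
whose ℤᵈ assembly is dag-n05-d's `B8Prop3PrintedZdGF3P2Gamma.prop3Printed_zdGF3P₂_map_γ` from dag-n06-b's both-points socket `SockB9P3H2` — UNGUARDED ([4] in infinite volume).
NODE N06's periodic objects can supply only the GUARDED text `B8LeafModelZd3SockH2Per.SockB9P3H2Per P …` (`U₀`, `W`, `A′` `P`-periodic; this seat's CLAIM-4, the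
both-points twin of dag-n06-b's `SockB9P3Per`).  As in the original currency, the assembly calls the socket EXACTLY
ONCE, at `(U₀, W := U₁, A := mlogCfg k η {Ω_j} U₁)`; on a periodic pair over periodic domains all three are periodic (`isPeriodic_mlogCfg_of_isPeriodic`), so the guarded socket
suffices.  Everything else is D3₂'s proof VERBATIM (this seat g0's γ engine `B8Prop3KLevelGamma.prop3_norms_kLevel_γ ∕ prop3_fifth_kLevel_γ ∕ prop3_windows_γ`, the box law
`towerBondsP_box_subset_pred`, `thm2_pointwise_A` — BY NAME).

## WHAT IS PROVED (kernel, 0 sorry, 0 def)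

* §1 ★★ `prop3Body_periodicPair_zdGF3P₂_γ_of_sockB9P3H2Per` — PROPOSITION 3's BODY AT ONE `ℤᵈ` δ₂-MEMBER `i` FOR EVERY PAIR WITH `P`-PERIODIC `U₀`, `U₁`, from `SockB9P3H2Per P …` at
  print's class `towerBondsP` at that member (threshold `min cP (c_N∕L²)` before the member), whenever `Ω_j` (`j ≤ k`) are `P`-periodic; `C₂ ≥ 2097152(d+1)²L²`.
* §2 ★★ `prop3Body_member_hp2per_γ_of_sockB9P3H2Per` · ★★ `prop3Printed_hp2per_map_γ_of_sockB9P3H2Per` — the periodic-FAMILY forms on dag-n05-c's P1′ `zdGF3HP₂Per` (pure-∀ corollaries).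
* §3 ★ `Node00.prop3_famB8OfRecordSubBP₂DPer_of_sockB9P3H2Per` · ★ `Node00.prop3_famB8OfRecordSubBP₂DPerκ_of_sockB9P3H2Per` — the record faces on this lineage's P2′ ∕ K2 (uncut periodic
  δ₂-family of record and its print-class cut `IdxB8SubDPerκ`): the `p3` conjunct of `B8LeafOfRecordSubBP₂DPer(κ)` is suppliable by NODE N06's PERIODIC objects.

## HONEST SCOPE

A re-run of a LANDED assembly with three periodicity threads; NO estimate of [B8] ∕ [4] proved anew; the socket body ([4] Thm 3.3 with (3.42)–(3.43), N06 content, `m ≥ 1` OPEN)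
remains a HYPOTHESIS in the guarded form N06's periodic objects address; count-neutral helper (K1⁹ `stmt-QuantumFields-27364`); N05 NOT discharged; no count claim; one finite `𝕋⁴`
programme at fixed `ε`, Bałaban AS PRINTED; the Yang–Mills mass gap (Clay) is NOT proved by any of this — R4 closes the conditional finite-`𝕋⁴` rung `BalabanLadder.UV` only; nothing
continuum ∕ ℝ⁴ ∕ OS.  No `sorry`, no `def`, no `instance`, no `notation`.  Unit `pub-ymgap-dag-n05-w1` (g4), 2026-08-28.

[cite: Balaban1985RegularSpaces, Prop. 3 p.87, (1.40)–(1.42) p.83, (1.57)–(1.62) pp.86–87, (1.36)–(1.39) p.82, (1.31) p.82, p.77; Balaban1985BackgroundPropagators, Thm 3.3 p.398, (3.40) p.397]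
-/

noncomputable section

open NormedSpace

namespace Literature.MathematicalPhysics.QuantumFieldTheory.Balaban1983to89.B8Prop3PrintedZdGF3P2GammaOfSockPer

open Complex (I)
open MatrixLog B7Prop1Explicit B7Prop2Explicit B7Prop1Local B7Eq92Concrete
open B7Prop2Explicit (C0 c2')
open B7Prop3Flat (c3)
open B8Ineq132 (covDerivFwd InAk BondTouches)
open B8Eq184Proof (gaugeExp cfgExp)
open B8Lemma1NonAbelian (mulCfg)
open B8Eq140Level (SideTouches)
open B8Eq146AExpansion (iEta expCfg plaqCovDeriv)
open B8Eq143PlaqExpansion (pdiv)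
open B7Prop4GeneralLevels (logCovIter linCovIter)
open B8Eq155JBound (Jcur wsup)
open B8ScaledSupNorm (bondNorm msup weight Bdd)
open B8Eq138LandauZd (IsLandau138W logCfg covLap)
open B8Prop3GaugeFixedKLevel (inAk_congr_of_sideTouches expCfg_iEta_eq_cfgExp cfgExp_congr_at)
open B8LeafModelZd (ZdIdx)
open B8LeafModelZd3 (mlogCfg mlogCfg_of_sideTouches mlogCfg_of_not)
open B8LeafModelZd3P2 (zdGF3P₂ zdGF3HP₂)
open B8LeafModelZdHP2Per (zdGF3HP₂Per)
open B8TowerBondsPrinted (towerBondsP towerBondsP_box_subset_pred)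
open B8Prop3KLevelGamma (prop3_norms_kLevel_γ prop3_fifth_kLevel_γ prop3_windows_γ)
open B9Eq340HolderZd (hquot AdmPair)
open B8LeafModelZd3SockH2Per (SockB9P3H2Per)
open B8LeafModelZdPerProp3OfSockPer (isPeriodic_mlogCfg_of_isPeriodic)
open T4TermwiseTorus (IsPeriodic)

-- `Site` alone could resolve to the torus sites of `Setup.lean`; re-export the `ℤ^d` sites of `B7Prop1Explicit`.
export B7Prop1Explicit (Site)

variable {d : ℕ}

section PeriodicPair

variable {𝔸 : Type} [CStarAlgebra 𝔸] [Nontrivial 𝔸]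

/-- ★★ **PROPOSITION 3 (p. 87) AT ONE δ₂-MEMBER `i` OF `zdGF3P₂`, FOR EVERY PAIR `(U₀, U₁U₀)` WITH `P`-PERIODIC `U₀`, `U₁`, FROM THE PERIODIC-GUARDED BOTH-POINTS SOCKET
`SockB9P3H2Per P …` AT PRINT's CLASS `towerBondsP`** — whenever the member's domains `Ω_j` (`j ≤ k`) are `P`-periodic; ONE threshold `min cP (c_N(d, L, B₀)∕L²)` before the
member.  PROOF = dag-n05-d's D3₂ `prop3Printed_zdGF3P₂_map_γ` VERBATIM (γ engines, box law «box ⊂ Ω_{j−1}», (1.42) = the P-carrier's `C137`, pointwise (1.36)₁), the socket called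
with its three guards (`A` periodic by `isPeriodic_mlogCfg_of_isPeriodic`).
[cite: Balaban1985RegularSpaces, Prop. 3 p.87, (1.40)–(1.42) p.83, (1.59)–(1.62) pp.86–87, (1.36)–(1.39) p.82, (1.31) p.82, p.77 («Ω_j ⊂ T_η»); Balaban1985BackgroundPropagators, Thm 3.3 p.398, (3.40) p.397] -/
theorem prop3Body_periodicPair_zdGF3P₂_γ_of_sockB9P3H2Per (hd2 : 2 ≤ d) {L : ℕ} (hL : 2 ≤ L) (inp : B8.B9Inputs) {B₀β C₂ cP : ℝ}
    (hB₀β : 0 ≤ B₀β) (hC₂ : 2097152 * ((d : ℝ) + 1) ^ 2 * (L : ℝ) ^ 2 ≤ C₂) (hcP : 0 < cP) (β : ℝ) (len : Site d → ℝ) :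
    ∃ c : ℝ, 0 < c ∧ ∀ (i : ZdIdx d L) (P : ℕ), (∀ l, l ≤ i.k → IsPeriodic P (fun x : Site d => x ∈ i.Ω l)) →
      SockB9P3H2Per (𝔸 := 𝔸) P L inp.B₀ B₀β cP β len i.η i.k i.Ω i.Λs (fun m j => towerBondsP L i.Ω (i.Λs m) j) →
      ∀ α₀ α₁ α₂ : ℝ, 0 < α₀ → α₀ ≤ c → 0 < α₁ → α₁ ≤ c → 0 < α₂ → α₂ ≤ c →
        2 * α₂ ^ 2 + 20 * d * α₀ * α₂ + 2 * C₂ * α₂ ^ 2 ≤ α₀ + α₁ →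
        ∀ (U₀ : (zdGF3P₂ 𝔸 L β len i).Cfg) (U₁ : (zdGF3P₂ 𝔸 L β len i).Pert), IsPeriodic P U₀.1 → IsPeriodic P U₁.2.1 →
          (zdGF3P₂ 𝔸 L β len i).InA α₀ U₀ → (zdGF3P₂ 𝔸 L β len i).Reg335 α₀ U₀ → (zdGF3P₂ 𝔸 L β len i).InAPair α₀ U₀ U₁ →
          (zdGF3P₂ 𝔸 L β len i).C162 1 α₂ U₀ U₁ → (zdGF3P₂ 𝔸 L β len i).Landau U₀ U₁ → (zdGF3P₂ 𝔸 L β len i).C137 α₁ U₀ U₁ →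
            (zdGF3P₂ 𝔸 L β len i).C136 (5 * d * (L : ℝ) * inp.B₀) (5 * d * (L : ℝ) * B₀β) (α₀ + α₁) U₀ U₁ ∧
            (zdGF3P₂ 𝔸 L β len i).C139 (5 * d * (L : ℝ) * inp.B₀) (α₀ + α₁) U₀ U₁ := by
  have hL1 : 1 ≤ L := le_trans (by norm_num) hL
  have hLr : (1 : ℝ) ≤ L := by exact_mod_cast hL1
  have hL0 : (0 : ℝ) < L := by linarith
  have hB₀ : 0 ≤ inp.B₀ := inp.B₀_pos.le
  obtain ⟨cN, hcN, hwin⟩ := prop3_windows_γ hd2 hL hB₀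
  refine ⟨min cP (cN / (L : ℝ) ^ 2), lt_min hcP (by positivity), ?_⟩
  intro i Pp hΩ SB9P α₀ α₁ α₂ hα₀ hα₀c hα₁ _ hα₂ hα₂c h61 U₀ P hU₀p hWp hInA _ hPair h162 hLan h137
  have hα₀P : α₀ ≤ cP := hα₀c.trans (min_le_left _ _)
  have hα₂P : α₂ ≤ cP := hα₂c.trans (min_le_left _ _)
  have hL2 : (0 : ℝ) < (L : ℝ) ^ 2 := by positivity
  have hα₀N : (L : ℝ) ^ 2 * α₀ ≤ cN := by
    have := hα₀c.trans (min_le_right _ _)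
    rw [le_div_iff₀ hL2] at this
    linarith
  have hα₂N : (L : ℝ) * α₂ ≤ cN := by
    have h1 := hα₂c.trans (min_le_right _ _)
    rw [le_div_iff₀ hL2] at h1
    have h2 : (L : ℝ) * α₂ ≤ α₂ * (L : ℝ) ^ 2 := by
      have h3 : (L : ℝ) * α₂ * 1 ≤ (L : ℝ) * α₂ * L := mul_le_mul_of_nonneg_left hLr (by positivity)
      nlinarith [h3]
    linarith
  obtain ⟨hα3, hα4, h16, hd5, hsmall, hc₃, hside, h50, hC⟩ := hwin α₀ α₂ hα₀ hα₀N hα₂.le hα₂N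
  have hC₂' : 8 * (131072 * ((d : ℝ) + 1) ^ 2) * Real.exp (4 * (800 * ((d : ℝ) + 1) ^ 2 * ((d : ℝ) + 4)) * ((L : ℝ) ^ 2 * α₀))
      * (L : ℝ) ^ 2 ≤ C₂ :=
    hC.trans hC₂
  -- the data
  set W : Site d → Fin d → 𝔸ˣ := P.2.1 with hW_def
  have hWu : ∀ x κ, W x κ ∈ unitaryUnits 𝔸 := P.2.2
  have hU₀ : ∀ x κ, U₀.1 x κ ∈ unitaryUnits 𝔸 := U₀.2
  set A : Site d → Fin d → 𝔸 := mlogCfg i.k i.η i.Ω W with hA_def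
  -- the three guards: `U₀`, `W` periodic (hypotheses), `A` periodic (the masked exponent of periodic data over periodic domains)
  have hAp : IsPeriodic Pp A := isPeriodic_mlogCfg_of_isPeriodic i.k i.η hΩ hWp
  -- (1.41) and self-adjointness of the canonical exponent; `W = e^{iηA}` on the `E j`
  have h41 : ∀ j, j ≤ i.k → ∀ (y : Site d) (τ : Fin d), SideTouches (i.Ω j) y τ →
      W y τ = cfgExp i.η A y τ ∧ ‖A y τ‖ ≤ α₂ * ((L : ℝ) ^ j * i.η)⁻¹ := by
    intro j hj y τ hs
    obtain ⟨hexp, -, hbd⟩ := h162 j hj (y, τ) hs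
    have hexp' : W y τ = cfgExp i.η (logCfg i.η W) y τ := hexp
    have hbd' : ‖logCfg i.η W y τ‖ ≤ 1 * α₂ * ((L : ℝ) ^ j * i.η)⁻¹ := hbd
    have hAy : A y τ = logCfg i.η W y τ := mlogCfg_of_sideTouches i.η W hj hs
    refine ⟨?_, ?_⟩
    · rw [hexp']
      exact cfgExp_congr_at i.η hAy.symm
    · rw [hAy]
      simpa only [one_mul] using hbd'
  have hAsa : ∀ y τ, IsSelfAdjoint (A y τ) := by
    intro y τ
    by_cases hmem : ∃ j, j ≤ i.k ∧ SideTouches (i.Ω j) y τ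
    · obtain ⟨j, hj, hs⟩ := hmem
      rw [hA_def, mlogCfg_of_sideTouches i.η W hj hs]
      exact (h162 j hj (y, τ) hs).2.1
    · rw [hA_def, mlogCfg_of_not i.η W fun j hj hs => hmem ⟨j, hj, hs⟩]
      exact IsSelfAdjoint.zero 𝔸
  have hA0 : ∀ (y : Site d) (τ : Fin d), (∀ j, j ≤ i.k → ¬ SideTouches (i.Ω j) y τ) → A y τ = 0 :=
    fun y τ h => mlogCfg_of_not i.η W h
  -- (1.40)₁ for `e^{iηA}U₀` by locality; the Landau clause for `e^{iηA}` by locality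
  have h40₁ : InAk L i.k i.η α₀ i.Ω (mulCfg (expCfg (iEta i.η A)) U₀.1) := by
    refine (inAk_congr_of_sideTouches L i.k i.η α₀ (V := mulCfg W U₀.1) fun j hj y τ hs => ?_).1 hPair
    show W y τ * U₀.1 y τ = expCfg (iEta i.η A) y τ * U₀.1 y τ
    rw [(h41 j hj y τ hs).1, expCfg_iEta_eq_cfgExp]
  -- the global bound and the gradient datum (bounded family)
  have hAglob : ∀ y τ, ‖A y τ‖ ≤ α₂ * i.η⁻¹ := by
    intro y τ
    by_cases hmem : ∃ j, j ≤ i.k ∧ SideTouches (i.Ω j) y τ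
    · obtain ⟨j, hj, hs⟩ := hmem
      have hLj : (1 : ℝ) ≤ (L : ℝ) ^ j := one_le_pow₀ hLr
      have hη0 : 0 < i.η := i.hη
      calc ‖A y τ‖ ≤ α₂ * ((L : ℝ) ^ j * i.η)⁻¹ := (h41 j hj y τ hs).2
        _ = α₂ * i.η⁻¹ * ((L : ℝ) ^ j)⁻¹ := by rw [mul_inv]; ring
        _ ≤ α₂ * i.η⁻¹ * 1 := by
            apply mul_le_mul_of_nonneg_left (inv_le_one_of_one_le₀ hLj) (by positivity)
        _ = α₂ * i.η⁻¹ := mul_one _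
    · rw [hA0 y τ fun j hj hs => hmem ⟨j, hj, hs⟩, norm_zero]
      have hη0 : 0 < i.η := i.hη
      positivity
  have hU₀1 : ∀ x κ, U₀.1 x κ ∈ U1 𝔸 := fun x κ => unitaryUnits_le_U1 (hU₀ x κ)
  have hgrad : ∀ (y : Site d) (κ τ : Fin d), ‖covDerivFwd i.η U₀.1 κ (fun z => A z τ) y‖ ≤ 2 * α₂ * i.η⁻¹ * i.η⁻¹ := by
    intro y κ τ
    have hη0 : 0 < i.η := i.hη
    unfold covDerivFwd
    rw [norm_smul, norm_inv, Real.norm_eq_abs, abs_of_pos hη0]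
    have h1 : ‖B7Eq78Linearization.conjR (U₀.1 y κ) (A (y + e κ) τ) - A y τ‖ ≤ α₂ * i.η⁻¹ + α₂ * i.η⁻¹ := by
      calc ‖B7Eq78Linearization.conjR (U₀.1 y κ) (A (y + e κ) τ) - A y τ‖
          ≤ ‖B7Eq78Linearization.conjR (U₀.1 y κ) (A (y + e κ) τ)‖ + ‖A y τ‖ := norm_sub_le _ _
        _ ≤ α₂ * i.η⁻¹ + α₂ * i.η⁻¹ := by
            rw [B8Ineq132.norm_conjR (hU₀1 y κ)]
            exact add_le_add (hAglob _ _) (hAglob _ _)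
    calc i.η⁻¹ * ‖B7Eq78Linearization.conjR (U₀.1 y κ) (A (y + e κ) τ) - A y τ‖ ≤ i.η⁻¹ * (α₂ * i.η⁻¹ + α₂ * i.η⁻¹) :=
        mul_le_mul_of_nonneg_left h1 (by positivity)
      _ = 2 * α₂ * i.η⁻¹ * i.η⁻¹ := by ring
  have hBg : Bdd L i.k i.η (-(2 : ℝ)) (fun j (t : Fin d × Fin d × Site d) => SideTouches (i.Ω j) t.2.2 t.2.1)
      (fun t => covDerivFwd i.η U₀.1 t.1 (fun z => A z t.2.1) t.2.2) := by
    have e2 : (-(2 : ℝ)) = -((2 : ℕ) : ℝ) := by norm_num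
    rw [e2]
    refine B8ScaledSupNorm.bdd_of_forall (c := 2 * α₂ * ((L : ℝ) ^ i.k) ^ 2) fun j hj t _ => ?_
    rw [B8ScaledSupNorm.weight_neg_natCast L i.η 2 j]
    have hLjk : (L : ℝ) ^ j ≤ (L : ℝ) ^ i.k := pow_le_pow_right₀ hLr hj
    have hLj0 : (0 : ℝ) ≤ (L : ℝ) ^ j := by positivity
    have hη0 : 0 < i.η := i.hη
    calc ((L : ℝ) ^ j * i.η) ^ 2 * ‖covDerivFwd i.η U₀.1 t.1 (fun z => A z t.2.1) t.2.2‖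
        ≤ ((L : ℝ) ^ j * i.η) ^ 2 * (2 * α₂ * i.η⁻¹ * i.η⁻¹) := mul_le_mul_of_nonneg_left (hgrad _ _ _) (by positivity)
      _ = 2 * α₂ * ((L : ℝ) ^ j) ^ 2 := by field_simp
      _ ≤ 2 * α₂ * ((L : ℝ) ^ i.k) ^ 2 := by gcongr
  set g : ℝ := msup L i.k i.η (-(2 : ℝ)) (fun j (t : Fin d × Fin d × Site d) => SideTouches (i.Ω j) t.2.2 t.2.1)
      (fun t => covDerivFwd i.η U₀.1 t.1 (fun z => A z t.2.1) t.2.2) with hg_def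
  have hg0 : 0 ≤ g := B8ScaledSupNorm.msup_nonneg L i.k i.hη.le _ _ _
  have hg : ∀ j, j ≤ i.k → ∀ (y : Site d) (κ τ : Fin d), SideTouches (i.Ω j) y τ →
      ((L : ℝ) ^ j * i.η) ^ 2 * ‖covDerivFwd i.η U₀.1 κ (fun z => A z τ) y‖ ≤ g := by
    intro j hj y κ τ hs
    have h := B8ScaledSupNorm.weight_mul_norm_le_msup hBg hj (i := (κ, τ, y)) hs
    have hw : weight L i.η (-(2 : ℝ)) j = ((L : ℝ) ^ j * i.η) ^ 2 := by
      have e2 : (-(2 : ℝ)) = -((2 : ℕ) : ℝ) := by norm_num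
      rw [e2, B8ScaledSupNorm.weight_neg_natCast L i.η 2 j]
    rw [hw] at h
    exact h
  -- the Landau clause for `e^{iηA}` and the in-edge (1.59), five lines, from the GUARDED socket (three periodicity threads)
  have hLanA : IsLandau138W L i.k i.η (i.Ω 0) (i.Λs i.k) U₀.1 W := hLan
  obtain ⟨h59a, h59g, h59j, h59l, h59h⟩ :=
    SB9P α₀ α₂ hα₀ hα₀P hα₂ hα₂P U₀.1 W hU₀ hWu hU₀p hWp hInA hPair hLanA A hAsa hAp h41 hA0
  -- (1.42) = the P-carrier's (1.37) clause, on PRINT's class of the top truncation (inner AND crossing bonds); the γ box law «box ⊂ Ω_{j−1}»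
  have hbox : ∀ j, j ≤ i.k → ∀ c ∈ towerBondsP L i.Ω (i.Λs i.k) j, ∀ x, InBox (loK L j c.1) (bondHiK L j c.1 c.2) x → x ∈ i.Ω (j - 1) :=
    fun j _ c hc x hx => towerBondsP_box_subset_pred L i.hΩ (i.Λs i.k) hc x hx
  have h42 : ∀ j, j ≤ i.k → ∀ c ∈ towerBondsP L i.Ω (i.Λs i.k) j, ‖logCovIter L U₀.1 (iEta i.η A) j c.1 c.2‖ < 2 * d * L * α₁ := h137
  have h41' : ∀ j, j ≤ i.k → ∀ (y : Site d) (τ : Fin d), SideTouches (i.Ω j) y τ → ‖A y τ‖ ≤ α₂ * ((L : ℝ) ^ j * i.η)⁻¹ :=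
    fun j hj y τ hs => (h41 j hj y τ hs).2
  -- PROPOSITION 3 at `k` levels (n05-b), all four members, and the Hölder member
  obtain ⟨ha, hg', hj, hl⟩ := prop3_norms_kLevel_γ hd2 i.hη hL hU₀ hAsa hα₀ hα₁.le hα₂.le hg0 hα3 hα4 h16 hd5
    hsmall hc₃ hB₀ hside h50 hC₂' h61 hbox hInA h40₁ h41' hg h42 h59a h59g h59j h59l
  have hh := prop3_fifth_kLevel_γ hd2 i.hη hL hU₀ hAsa hα₀ hα₁.le hα₂.le hg0 hα3 hα4 h16 hd5 hsmall hc₃ hB₀ hB₀β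
    hside h50 hC₂' h61 hbox hInA h40₁ h41' hg h42 h59g h59h
  refine ⟨⟨fun j hj b hb => ?_, hg', hh⟩, hj, hl⟩
  -- (1.36)₁ pointwise on the `E j`, read on the logarithm
  obtain ⟨hexp, hsa, -⟩ := h162 j hj b hb
  refine ⟨hexp, hsa, ?_⟩
  have hpt := B8Thm2GaugeFixedKLevel.thm2_pointwise_A i.hη hL1 h41' ha hj (y := b.1) (τ := b.2) hb
  rw [← mlogCfg_of_sideTouches i.η W hj hb]
  exact hpt


end PeriodicPair

/-! ## §2 Proposition 3 on the periodic δ₂-family `zdGF3HP₂Per` from the guarded both-points socket -/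

section PerFamily

variable {𝔸 : Type} [CStarAlgebra 𝔸] [Nontrivial 𝔸]

/-- ★★ **`B8.Prop3Body` AT ONE MEMBER OF THE PERIODIC δ₂-FAMILY `zdGF3HP₂Per`, GUARDED BOTH-POINTS SOCKET INSIDE** (`Unit`-family form): ONE threshold before the member; at a member `i` with
`P`-periodic domains the PERIODIC-GUARDED socket `SockB9P3H2Per P …` at print's class `towerBondsP` yields Proposition 3's body for the periodic δ₂-member (whose configurations and perturbations ARE
`P`-periodic — §1 at the underlying fields; the `GFData2` parts of `zdGF3HP₂` and `zdGF3P₂` agree by `rfl`). [cite: Balaban1985RegularSpaces, Prop. 3 p.87, (1.40)–(1.42) p.83, (1.59)–(1.62) pp.86–87, p.77 («Ω_j ⊂ T_η»); Balaban1985BackgroundPropagators, Thm 3.3 p.398, (3.40) p.397] -/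
theorem prop3Body_member_hp2per_γ_of_sockB9P3H2Per (hd2 : 2 ≤ d) {L : ℕ} (hL : 2 ≤ L) (inp : B8.B9Inputs) {B₀β C₂ cP : ℝ}
    (hB₀β : 0 ≤ B₀β) (hC₂ : 2097152 * ((d : ℝ) + 1) ^ 2 * (L : ℝ) ^ 2 ≤ C₂) (hcP : 0 < cP) (β : ℝ) (len : Site d → ℝ) :
    ∃ c : ℝ, 0 < c ∧ ∀ (i : ZdIdx d L) (P : ℕ), (∀ l, l ≤ i.k → IsPeriodic P (fun x : Site d => x ∈ i.Ω l)) →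
      SockB9P3H2Per (𝔸 := 𝔸) P L inp.B₀ B₀β cP β len i.η i.k i.Ω i.Λs (fun m j => towerBondsP L i.Ω (i.Λs m) j) →
      B8.Prop3Body c d (L : ℝ) C₂ inp B₀β (fun _ : Unit => (zdGF3HP₂Per 𝔸 L β len i P).toGFData2) := by
  obtain ⟨c, hc, H⟩ := prop3Body_periodicPair_zdGF3P₂_γ_of_sockB9P3H2Per (𝔸 := 𝔸) hd2 hL inp hB₀β hC₂ hcP β len
  refine ⟨c, hc, fun i P hΩ SB9P => ?_⟩
  intro _ α₀ α₁ α₂ hα₀ hα₀c hα₁ hα₁c hα₂ hα₂c h61 U₀ Q hInA hReg hPair h162 hLan h137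
  exact H i P hΩ SB9P α₀ α₁ α₂ hα₀ hα₀c hα₁ hα₁c hα₂ hα₂c h61 (⟨U₀.1, U₀.2.1⟩ : (zdGF3P₂ 𝔸 L β len i).Cfg)
    ((⟨Q.1.1, Q.1.2.1⟩, ⟨Q.2.1, Q.2.2.1⟩) : (zdGF3P₂ 𝔸 L β len i).Pert) U₀.2.2 Q.2.2.2 hInA hReg hPair h162 hLan h137

/-- ★★ **`B8.Prop3Printed` ON THE PERIODIC δ₂-FAMILY, GUARDED BOTH-POINTS SOCKET ON THE IMAGE MEMBERS ONLY** — along any index ∕ period maps `ι, p` whose members have `(p j)`-periodic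
domains `Ω_l`, `l ≤ k`, from `SockB9P3H2Per (p j) …` at print's class `towerBondsP` at the members `ι j` ONLY (the form NODE N06's periodic objects feed on the (β′-PERIODIC) road under (ii)).
[cite: Balaban1985RegularSpaces, Prop. 3 p.87, (1.36)–(1.40) pp.82–83, (1.59) p.86, p.77 («Ω_j ⊂ T_η»); Balaban1985BackgroundPropagators, Thm 3.3 p.398, (3.40) p.397] -/
theorem prop3Printed_hp2per_map_γ_of_sockB9P3H2Per (hd2 : 2 ≤ d) {L : ℕ} (hL : 2 ≤ L) (inp : B8.B9Inputs) {B₀β C₂ cP : ℝ}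
    (hB₀β : 0 ≤ B₀β) (hC₂ : 2097152 * ((d : ℝ) + 1) ^ 2 * (L : ℝ) ^ 2 ≤ C₂) (hcP : 0 < cP) (β : ℝ) (len : Site d → ℝ)
    {J : Type} (ι : J → ZdIdx d L) (p : J → ℕ)
    (hΩ : ∀ j l, l ≤ (ι j).k → IsPeriodic (p j) (fun x : Site d => x ∈ (ι j).Ω l))
    (SB9P : ∀ j : J, SockB9P3H2Per (𝔸 := 𝔸) (p j) L inp.B₀ B₀β cP β len (ι j).η (ι j).k (ι j).Ω (ι j).Λs
      (fun m l => towerBondsP L (ι j).Ω ((ι j).Λs m) l)) :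
    B8.Prop3Printed d (L : ℝ) C₂ inp B₀β (fun j : J => (zdGF3HP₂Per 𝔸 L β len (ι j) (p j)).toGFData2) := by
  obtain ⟨c, hc, H⟩ := prop3Body_member_hp2per_γ_of_sockB9P3H2Per (𝔸 := 𝔸) hd2 hL inp hB₀β hC₂ hcP β len
  exact ⟨c, hc, fun j => H (ι j) (p j) (hΩ j) (SB9P j) ()⟩

end PerFamily

end Literature.MathematicalPhysics.QuantumFieldTheory.Balaban1983to89.B8Prop3PrintedZdGF3P2GammaOfSockPer

/-! ## §3 The record faces: Proposition 3 at the periodic δ₂-family of record (uncut and κ-cut) from the guarded both-points socket at the periodic members -/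

namespace Literature.MathematicalPhysics.QuantumFieldTheory.Balaban1983to89.Node00

open B8LeafModelZd3SockH2Per (SockB9P3H2Per)
open B8TowerBondsPrinted (towerBondsP)
open B8Prop3PrintedZdGF3P2GammaOfSockPer (prop3Printed_hp2per_map_γ_of_sockB9P3H2Per)

variable {θ : Stage3Params} {P M₁ R : ℕ}

/-- ★ **PROPOSITION 3 AT THE PERIODIC δ₂-FAMILY OF RECORD `famB8OfRecordSubBP₂DPer θ β len P`, modulo the PERIODIC-GUARDED both-points socket `SockB9P3H2Per P` at print's class `towerBondsP`
AT THE PERIODIC (1.5)-MEMBERS ONLY** — P2′'s `CarriersB8SubBP2DPer.prop3_famB8OfRecordSubBP₂DPer` re-keyed on the guarded socket (`hΩ := j.periodic`): `θ.D ≥ 2`, `C₂ ≥ 2097152(d+1)²L²`, `B₀(β₀) ≥ 0`.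
The `p3` conjunct of `B8LeafOfRecordSubBP₂DPer` is thus suppliable by NODE N06's PERIODIC objects. [cite: Balaban1985RegularSpaces, Prop. 3 p.87, (1.59) p.86, p.77 («Ω_j ⊂ T_η»); Balaban1985BackgroundPropagators, Thm 3.3 p.399, (3.40) p.397] -/
theorem prop3_famB8OfRecordSubBP₂DPer_of_sockB9P3H2Per (hD : 2 ≤ θ.D) (inp : B8.B9Inputs) {B₀β C₂ cP : ℝ} (hB₀β : 0 ≤ B₀β)
    (hC₂ : 2097152 * ((θ.D : ℝ) + 1) ^ 2 * (θ.L : ℝ) ^ 2 ≤ C₂) (hcP : 0 < cP) (β : ℝ) (len : B7Prop1Explicit.Site θ.D → ℝ)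
    (SB9P : ∀ j : IdxB8SubDPer θ P, SockB9P3H2Per (𝔸 := θ.𝔸) P θ.L inp.B₀ B₀β cP β len j.toZdIdx.η j.toZdIdx.k j.toZdIdx.Ω j.toZdIdx.Λs
      (fun m l => towerBondsP θ.L j.toZdIdx.Ω (j.toZdIdx.Λs m) l)) :
    B8.Prop3Printed θ.D (θ.L : ℝ) C₂ inp B₀β (fun j : IdxB8SubDPer θ P => (famB8OfRecordSubBP₂DPer θ β len P j).toGFData2) :=
  prop3Printed_hp2per_map_γ_of_sockB9P3H2Per hD θ.two_le_L inp hB₀β hC₂ hcP β len (fun j : IdxB8SubDPer θ P => j.toZdIdx) (fun _ => P)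
    (fun j l _ => j.periodic l) SB9P

/-- ★ **THE SAME ON THE PRINT-CLASS CUT** `IdxB8SubDPerκ θ P M₁ R` (director-ym №220 (A-4); K2's `prop3_famB8OfRecordSubBP₂DPerκ` re-keyed on the guarded socket): the `p3` conjunct of the κ-slot
`B8LeafOfRecordSubBP₂DPerκ` from `SockB9P3H2Per P` at the cut members only. [cite: Balaban1985RegularSpaces, Prop. 3 p.87, (1.3)–(1.4) p.77, p.77 («Ω_j ⊂ T_η»); Balaban1985BackgroundPropagators, Thm 3.3 p.399, (3.40) p.397] -/
theorem prop3_famB8OfRecordSubBP₂DPerκ_of_sockB9P3H2Per (hD : 2 ≤ θ.D) (inp : B8.B9Inputs) {B₀β C₂ cP : ℝ} (hB₀β : 0 ≤ B₀β)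
    (hC₂ : 2097152 * ((θ.D : ℝ) + 1) ^ 2 * (θ.L : ℝ) ^ 2 ≤ C₂) (hcP : 0 < cP) (β : ℝ) (len : B7Prop1Explicit.Site θ.D → ℝ)
    (SB9P : ∀ j : IdxB8SubDPerκ θ P M₁ R, SockB9P3H2Per (𝔸 := θ.𝔸) P θ.L inp.B₀ B₀β cP β len j.toZdIdx.η j.toZdIdx.k j.toZdIdx.Ω j.toZdIdx.Λs
      (fun m l => towerBondsP θ.L j.toZdIdx.Ω (j.toZdIdx.Λs m) l)) :
    B8.Prop3Printed θ.D (θ.L : ℝ) C₂ inp B₀β (fun j : IdxB8SubDPerκ θ P M₁ R => (famB8OfRecordSubBP₂DPer θ β len P j.1).toGFData2) :=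
  prop3Printed_hp2per_map_γ_of_sockB9P3H2Per hD θ.two_le_L inp hB₀β hC₂ hcP β len (fun j : IdxB8SubDPerκ θ P M₁ R => j.toZdIdx) (fun _ => P)
    (fun j l _ => j.periodic l) SB9P

end Literature.MathematicalPhysics.QuantumFieldTheory.Balaban1983to89.Node00

end
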